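import Summits.CriticalPhenomena.PercolationContinuityZ3.Theorems.Transplant.SkelPhiConcReachHabRes
import Summits.CriticalPhenomena.PercolationContinuityZ3.Theorems.Transplant.SkelPhiWinChainF2
import Summits.CriticalPhenomena.PercolationContinuityZ3.Theorems.Transplant.SkelKitResiduesHabN
import HarnessLib

/-!
# N1 (the `{±1}` node), (C) column: THE CORRIDOR RESIDUE `Skel.ReachOblAtHN G nmax` OF A TWO-UNIT CONCENTRIC SCHEME `⟨cellGeomSG G ρ P t Λ, q, δc⟩`
# FROM A TWO-WINDOW CHAIN — segment 1 read through the scheme's own window map `ρ` (N1: the coarse cell skeleton), segment 2 through ANY other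
# 1-Lipschitz map `ψ` (N1: p1-g11's run frame `runX`), both inside the fresh habitat `Ω = E^{α}_{x,y} ∪ H^{a'}_{y,y+du}` (`Skelφ.habΩ G ρ P t …`).
# Two-frame twin of p5-g6's `Skelφ.reachOblAtH_of_schedule` (SkelPhiConcReachHabRes): the planar schedule is replaced by two route-free frames
# `S₁ S₂ : ChainPlanar.SchedFrame`, the chain by `WinChainData.chain₂` (SkelPhiWinChainF2), the rooms of segment 2 are VERTEX-LEVEL readings
# (`ψ v ∈ S₂.region k ⇒ ρ v ∈ Q_y ∪ H_{y,du}`, supplied by the frame-change arithmetic), the scheme-geometry records `LevelGeom/QSepGeom/StepsGeom/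
# ExitGeom` and the nonempty true targets are HYPOTHESES (at `ρ = coarseSkel …` they are the business of the regions file: `Steps` of the window
# map is NOT available — HOME/prim-bschramm-p5-g8/C-FUNNEL.md, lane INBOX 2026-08-21T13:23Z), and the landing uses `Lip` of `ρ` only (last core inside
# `M_{y+du}` SHRUNK by one unit).

builds on p205010 (kernel theorem, internal audit signed; external expert review pending) — nothing in this file uses p205010; nothing here is a
claim about the open node `SamePDropOfSkeletonNeg`.
Lane `prim-bschramm`, seat `prim-bschramm-p5` (gen 8; (C) lineage; p3-g8 ruling 13:01Z: two-frame chain); helper file (`--supports stmt-CriticalPhenomena-4575`).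
* **`Skelφ.reachOblAtHN_of_schedules₂`** (hlipρ, hlipψ; hL hQ hSt hEx; `Valid₂`, `a' ∈ {α, α+1}`, `du` onward, `du ≠ rev e.2`; frames `S₁` (over `ρ`: `hM0`,
  `hreg₁`) and `S₂` (over `ψ`: cross link `hx`, readings `hreg₂`, `hlast₂`), `S₁.N + 1 + S₂.N ≤ nmax`; chain data `P₁ P₂` (sources `t`, supports `Sx`, rim
  parts inside the regions, level windows), nonempty true targets, the depth room `hρM`; `hcount₁₂`, `hkits₁₂`, `hη`, `hexc₁₂` ⟹ `Skel.ReachOblAtHN G nmax …`).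
[cite: KozmaNitzan2024, §4 Lemma 12 (pp. 23–25), p. 26 (M_x, H_{v,x}), p. 30 (Step IV), p. 31]
-/

noncomputable section

open MeasureTheory ProbabilityTheory
open scoped ENNReal Classical

namespace Summit.CriticalPhenomena.PercolationContinuityZ3.Theorems

namespace Transplant

namespace Skelφ

open Literature.Probability.Percolation Literature.Probability.LatticeModels SimpleGraph GadgetSystem ProbeHistory HSiteScheme Contour KNCells
open KNCells.KSchA KNLevels ChainPlanar
open Literature.Barriers.CriticalPhenomena (graphBall mem_graphBall_self graphBall_mono)
open BoxProdZ2 (ConcRadiiG)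
open PlanarSkeletonConc (mem_vspan_edgesIn_iff mem_vspan_edgesIn_of_adj)
open Skel (winGraphIn winGraphIn_le ReachOblAtHN isSubbox_Wcor_hab)

variable {V : Type} [DecidableEq V] {G : SimpleGraph V} [G.LocallyFinite] {ρ ψ : V → Site 2}

/-- **THE CORRIDOR RESIDUE OF THE TWO-UNIT SCHEME FROM A TWO-WINDOW CHAIN, HABITAT FORM** (N1 (C) design: phase 1 over the scheme map `ρ`, the
frame change, phases 2–3 over `ψ`): `Skel.ReachOblAtHN G nmax` at the probe `(h, e, a', du)` from two route-free schedule frames — `S₁` read through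
`ρ` (start: `M_y ⊆ core 0`; regions planar-inside `Q_y ∪ H_{y,du}`), `S₂` read through `ψ` (cross link from the last core of `S₁`; regions and the
shrunk last core read back into `ρ` at vertex level) — the scheme-geometry records, nonempty true targets, the depth room of `M_{y+du}`, and the
analytic inputs (counts, per-step kits under the corridor law, rim excess) of both segments.
[cite: KozmaNitzan2024, §4 Lemma 12 (pp. 23–25), p. 30 (Step IV), p. 31] -/
theorem reachOblAtHN_of_schedules₂ (hlipρ : Lip G ρ) (hlipψ : Lip G ψ) {P : PCells2} {t : V} {Λ : ConcRadiiG}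
    (hL : LevelGeom G (cellGeomSG G ρ P t Λ) (faceDataSG G ρ P t Λ) (levelDataS ρ P)) (hQ : QSepGeom G (cellGeomSG G ρ P t Λ))
    (hSt : StepsGeom (cellGeomSG G ρ P t Λ) (faceDataSG G ρ P t Λ)) (hEx : ExitGeom G (cellGeomSG G ρ P t Λ))
    {q : unitInterval} {δc : ℝ} {h : ProbeHistory V} {e : Site 2 × MDir}
    (hV : (⟨cellGeomSG G ρ P t Λ, q, δc⟩ : KSchA V ℕ).Valid₂ G h e) {a' : ℕ}
    (ha' : a' ∈ ({(⟨cellGeomSG G ρ P t Λ, q, δc⟩ : KSchA V ℕ).aOf₁ G h e, (⟨cellGeomSG G ρ P t Λ, q, δc⟩ : KSchA V ℕ).aOf₁ G h e + 1} : Finset ℕ))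
    {du : MDir} (hdu : du ∈ (⟨cellGeomSG G ρ P t Λ, q, δc⟩ : KSchA V ℕ).onward G h (tgt e)) (hdur : du ≠ rev e.2) {nmax : ℕ}
    -- segment 1: a route-free frame over `ρ`
    (S₁ : SchedFrame) (hM0 : P.M (tgt e) ⊆ S₁.core 0) (hreg₁ : ∀ k ≤ S₁.N, S₁.region k ⊆ P.Q (tgt e) ∪ P.Hfull (tgt e) du)
    -- segment 2: a route-free frame over `ψ`, the cross link and the vertex-level readings
    (S₂ : SchedFrame)
    (hx : WinIn ρ (habΩ G ρ P t (Λ := Λ) q δc h e a' du) (S₁.core (S₁.N + 1)) ⊆ WinIn ψ (habΩ G ρ P t (Λ := Λ) q δc h e a' du) (S₂.core 0))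
    (hreg₂ : ∀ k ≤ S₂.N, ∀ v ∈ habΩ G ρ P t (Λ := Λ) q δc h e a' du, ψ v ∈ S₂.region k → ρ v ∈ P.Q (tgt e) ∪ P.Hfull (tgt e) du)
    (hlast₂ : ∀ v ∈ habΩ G ρ P t (Λ := Λ) q δc h e a' du, ψ v ∈ S₂.core (S₂.N + 1) →
      Finset.Icc (ρ v - 1) (ρ v + 1) ⊆ P.M (tgt e + stepVec du) ∧ ρ v ∈ P.Hfull (tgt e) du)
    (hn : S₁.N + 1 + S₂.N ≤ nmax)
    -- the chain data of the two segments
    (P₁ P₂ : WinChainData V) (hPo₁ : P₁.o = t) (hPo₂ : P₂.o = t)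
    (hPS₁ : P₁.Sfin = (⟨cellGeomSG G ρ P t Λ, q, δc⟩ : KSchA V ℕ).Sx G h e ((⟨cellGeomSG G ρ P t Λ, q, δc⟩ : KSchA V ℕ).aOf₁ G h e) a' du)
    (hPS₂ : P₂.Sfin = (⟨cellGeomSG G ρ P t Λ, q, δc⟩ : KSchA V ℕ).Sx G h e ((⟨cellGeomSG G ρ P t Λ, q, δc⟩ : KSchA V ℕ).aOf₁ G h e) a' du)
    (hRim₁ : ∀ k, P₁.Rim k ⊆ (planarWindowIn hlipρ (habΩ G ρ P t (Λ := Λ) q δc h e a' du)).stepDF S₁ k)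
    (hRim₂ : ∀ k, P₂.Rim k ⊆ (planarWindowIn hlipψ (habΩ G ρ P t (Λ := Λ) q δc h e a' du)).stepDF S₂ k)
    (hRl₁ : P₁.Rlev + 1 ≤ S₁.R') (hRl₂ : P₂.Rlev + 1 ≤ S₂.R') (hj₁ : P₁.j₁ ≤ P₁.Rlev) (hj₂ : P₂.j₁ ≤ P₂.Rlev)
    (hTne₁ : ∀ k ≤ S₁.N, ((planarWindowIn hlipρ (habΩ G ρ P t (Λ := Λ) q δc h e a' du)).coreTF S₁ k).Nonempty)
    (hTne₂ : ∀ k ≤ S₂.N, ((planarWindowIn hlipψ (habΩ G ρ P t (Λ := Λ) q δc h e a' du)).coreTF S₂ k).Nonempty)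
    -- depth room: the corridor span's profile sits below the radius of `M^{a'}_{y+du}`
    (hρM : ∀ ℓ, Λ.ρ a' (tgt e) du ℓ + 1 ≤ Λ.rM a' (tgt e + stepVec du))
    -- the analytic inputs
    {Δ' : ℕ} {δ η : ℝ}
    (hcount₁ : 1 / (1 - (q : ℝ)) ^ (Δ' * P₁.N) ≤ δ * ((Finset.Icc P₁.j₀ P₁.j₁).card : ℝ))
    (hcount₂ : 1 / (1 - (q : ℝ)) ^ (Δ' * P₂.N) ≤ δ * ((Finset.Icc P₂.j₀ P₂.j₁).card : ℝ))
    (hkits₁ : ∀ k ≤ S₁.N, ∀ j ∈ Finset.Icc P₁.j₀ P₁.j₁, ∃ (σ : SData V) (Sz : Finset V),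
      SHyp (P₁.stepLF (planarWindowIn hlipρ (habΩ G ρ P t (Λ := Λ) q δc h e a' du)) S₁ k) j σ ∧ σ.N ≤ P₁.N ∧
      (1 - (q : ℝ) ^ σ.sB) ^ σ.k ≤ δ ∧ Sz ⊆ (P₁.stepLF (planarWindowIn hlipρ (habΩ G ρ P t (Λ := Λ) q δc h e a' du)) S₁ k).X j ∧
      Sz ⊆ (planarWindowIn hlipρ (habΩ G ρ P t (Λ := Λ) q δc h e a' du)).stepDF S₁ k ∧
      (∀ x ∈ σ.K, ∀ e' ∈ σ.seed x, e' ∉ wireSet (↑Sz : Set V)) ∧ (∀ x ∈ σ.K, σ.face x ⊆ Sz) ∧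
      (∀ x ∈ σ.K, 1 - 3 * δ ≤ (prodBernoulli ((⟨cellGeomSG G ρ P t Λ, q, δc⟩ : KSchA V ℕ).Wcor G (faceDataSG G ρ P t Λ) h e
          ((⟨cellGeomSG G ρ P t Λ, q, δc⟩ : KSchA V ℕ).aOf₁ G h e) a' du)).real {ω | ∃ u ∈ σ.face x,
        1 - δ < (prodBernoulli (pinW ((⟨cellGeomSG G ρ P t Λ, q, δc⟩ : KSchA V ℕ).Wcor G (faceDataSG G ρ P t Λ) h e
          ((⟨cellGeomSG G ρ P t Λ, q, δc⟩ : KSchA V ℕ).aOf₁ G h e) a' du) (wireSet (↑Sz : Set V)) ω)).real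
          (⋃ t' ∈ P₁.coreEF (planarWindowIn hlipρ (habΩ G ρ P t (Λ := Λ) q δc h e a' du)) S₁ k,
            openConnIn (↑((planarWindowIn hlipρ (habΩ G ρ P t (Λ := Λ) q δc h e a' du)).stepDF S₁ k) : Set V) u t')}))
    (hkits₂ : ∀ k ≤ S₂.N, ∀ j ∈ Finset.Icc P₂.j₀ P₂.j₁, ∃ (σ : SData V) (Sz : Finset V),
      SHyp (P₂.stepLF (planarWindowIn hlipψ (habΩ G ρ P t (Λ := Λ) q δc h e a' du)) S₂ k) j σ ∧ σ.N ≤ P₂.N ∧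
      (1 - (q : ℝ) ^ σ.sB) ^ σ.k ≤ δ ∧ Sz ⊆ (P₂.stepLF (planarWindowIn hlipψ (habΩ G ρ P t (Λ := Λ) q δc h e a' du)) S₂ k).X j ∧
      Sz ⊆ (planarWindowIn hlipψ (habΩ G ρ P t (Λ := Λ) q δc h e a' du)).stepDF S₂ k ∧
      (∀ x ∈ σ.K, ∀ e' ∈ σ.seed x, e' ∉ wireSet (↑Sz : Set V)) ∧ (∀ x ∈ σ.K, σ.face x ⊆ Sz) ∧
      (∀ x ∈ σ.K, 1 - 3 * δ ≤ (prodBernoulli ((⟨cellGeomSG G ρ P t Λ, q, δc⟩ : KSchA V ℕ).Wcor G (faceDataSG G ρ P t Λ) h e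
          ((⟨cellGeomSG G ρ P t Λ, q, δc⟩ : KSchA V ℕ).aOf₁ G h e) a' du)).real {ω | ∃ u ∈ σ.face x,
        1 - δ < (prodBernoulli (pinW ((⟨cellGeomSG G ρ P t Λ, q, δc⟩ : KSchA V ℕ).Wcor G (faceDataSG G ρ P t Λ) h e
          ((⟨cellGeomSG G ρ P t Λ, q, δc⟩ : KSchA V ℕ).aOf₁ G h e) a' du) (wireSet (↑Sz : Set V)) ω)).real
          (⋃ t' ∈ P₂.coreEF (planarWindowIn hlipψ (habΩ G ρ P t (Λ := Λ) q δc h e a' du)) S₂ k,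
            openConnIn (↑((planarWindowIn hlipψ (habΩ G ρ P t (Λ := Λ) q δc h e a' du)).stepDF S₂ k) : Set V) u t')}))
    (hη : η ≤ δ / 2)
    (hexc₁ : ∀ k ≤ S₁.N, (prodBernoulli ((⟨cellGeomSG G ρ P t Λ, q, δc⟩ : KSchA V ℕ).Wcor G (faceDataSG G ρ P t Λ) h e
        ((⟨cellGeomSG G ρ P t Λ, q, δc⟩ : KSchA V ℕ).aOf₁ G h e) a' du)).real (⋃ t' ∈ P₁.Rim k, openConn t t') ≤ η)
    (hexc₂ : ∀ k ≤ S₂.N, (prodBernoulli ((⟨cellGeomSG G ρ P t Λ, q, δc⟩ : KSchA V ℕ).Wcor G (faceDataSG G ρ P t Λ) h e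
        ((⟨cellGeomSG G ρ P t Λ, q, δc⟩ : KSchA V ℕ).aOf₁ G h e) a' du)).real (⋃ t' ∈ P₂.Rim k, openConn t t') ≤ η) :
    ReachOblAtHN G nmax (⟨cellGeomSG G ρ P t Λ, q, δc⟩ : KSchA V ℕ) (faceDataSG G ρ P t Λ) Δ' δ h e a' du := by
  -- abbreviations
  set S : KSchA V ℕ := ⟨cellGeomSG G ρ P t Λ, q, δc⟩ with hSdef
  set FD := faceDataSG G ρ P t Λ with hFDdef
  set α := S.aOf₁ G h e with hαdef
  set y := tgt e with hydef
  set Ω := habΩ G ρ P t (Λ := Λ) q δc h e a' du with hΩdef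
  set 𝒲₁ := planarWindowIn hlipρ Ω with h𝒲₁def
  set 𝒲₂ := planarWindowIn hlipψ Ω with h𝒲₂def
  have hroot' : S.Γ.root = t := rfl
  have ha'' : a' ∈ S.Γ.anchSet α y := ha'
  have hΩeq : Ω = S.Γ.Ewv α e.1 e.2 ∪ FD.Hfull a' y du := rfl
  -- every region lies in the fresh habitat and in `Q_α(y) ∪ E^far`
  have hDΩ₁ : ∀ k, 𝒲₁.stepDF S₁ k ⊆ S.Γ.Ewv α e.1 e.2 ∪ FD.Hfull a' y du := fun k v hv => by
    rw [← hΩeq]; exact ((mem_WinIn (φ := ρ)).1 hv).1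
  have hDΩ₂ : ∀ k, 𝒲₂.stepDF S₂ k ⊆ S.Γ.Ewv α e.1 e.2 ∪ FD.Hfull a' y du := fun k v hv => by
    rw [← hΩeq]; exact ((mem_WinIn (φ := ψ)).1 hv).1
  have hQH : ∀ {v : V}, v ∈ Ω → ρ v ∈ P.Q y ∪ P.Hfull y du → v ∈ S.Γ.Q α y ∪ S.Γ.Efar a' y du := by
    intro v hvΩ hvρ
    rcases mem_Q_or_Hfull_of_mem_habΩ hdur hvΩ hvρ with hvQ | hvH
    · exact Finset.mem_union_left _ hvQ
    · exact hSt.Hfull_subset _ _ _ _ ha'' hvH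
  have hDh₁ : ∀ k ≤ S₁.N, 𝒲₁.stepDF S₁ k ⊆ S.Γ.Q α y ∪ S.Γ.Efar a' y du := by
    intro k hk v hv
    obtain ⟨hvΩ, hvρ⟩ := (mem_WinIn (φ := ρ)).1 hv
    exact hQH hvΩ (hreg₁ k hk hvρ)
  have hDh₂ : ∀ k ≤ S₂.N, 𝒲₂.stepDF S₂ k ⊆ S.Γ.Q α y ∪ S.Γ.Efar a' y du := by
    intro k hk v hv
    obtain ⟨hvΩ, hvψ⟩ := (mem_WinIn (φ := ψ)).1 hv
    exact hQH hvΩ (hreg₂ k hk v hvΩ hvψ)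
  -- supports: regions inside `Sx`
  have hSx : ∀ {v : V}, v ∈ S.Γ.Q α y ∪ S.Γ.Efar a' y du → v ∈ S.Sx G h e α a' du := by
    intro v hv
    rcases Finset.mem_union.1 hv with hv' | hv'
    · exact Finset.mem_union_left _ (Finset.mem_union_right _ (Finset.mem_union_right _ hv'))
    · exact Finset.mem_union_right _ hv'
  -- the two-window chain
  have hC := WinChainData.chain₂ P₁ P₂ 𝒲₁ 𝒲₂ S₁ S₂ (hPo₂.trans hPo₁.symm) hRl₁ hRim₁ hTne₁ hRl₂ hRim₂ hTne₂
    hx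
    (fun k hk => isSubbox_Wcor_hab hL hQ hSt hV hdu ha'' (hDΩ₁ k) (hDh₁ k hk)) (by rw [hPS₁]; exact finSupp_Wcor)
    (fun k hk v hv => by rw [hPS₁]; exact hSx (hDh₁ k hk hv)) (fun k hk => by rw [hPo₁]; exact root_not_mem_of_fresh hL hQ hV hdu (hDh₁ k hk))
    (by rw [hPo₁, hPS₁]; exact Finset.mem_union_left _ (Finset.mem_union_left _ hV.root_mem)) hj₁ hcount₁ hkits₁
    (fun k hk => by rw [hPo₁]; exact hexc₁ k hk)
    (fun k hk => isSubbox_Wcor_hab hL hQ hSt hV hdu ha'' (hDΩ₂ k) (hDh₂ k hk)) (by rw [hPS₂]; exact finSupp_Wcor)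
    (fun k hk v hv => by rw [hPS₂]; exact hSx (hDh₂ k hk hv)) (fun k hk => by rw [hPo₂]; exact root_not_mem_of_fresh hL hQ hV hdu (hDh₂ k hk))
    (by rw [hPo₂, hPS₂]; exact Finset.mem_union_left _ (Finset.mem_union_left _ hV.root_mem)) hj₂ hcount₂ hkits₂
    (fun k hk => by rw [hPo₁]; exact hexc₂ k hk)
  obtain ⟨ho, hlink, hsub, hkits, hexc, h0, hlast⟩ := hC
  refine ⟨S₁.N + 1 + S₂.N, hn, Ω, fun i => WinChainData.stepAF₂ P₁ P₂ 𝒲₁ 𝒲₂ S₁ S₂ i, fun i => WinChainData.coreTF₂ 𝒲₁ 𝒲₂ S₁ S₂ i, η,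
    fun i => (ho i).trans hPo₁, hlink, hsub, hkits, hη, fun i => by rw [hroot', ← hPo₁]; exact hexc i, ?_, ?_⟩
  · -- the arrival cube `M_α(y) ⊆ Q_α(y) ⊆ Ω`, footprint in `P.M y ⊆ core 0`
    rw [h0]
    intro v hv
    refine (mem_WinIn (φ := ρ)).2 ⟨Finset.mem_union_left _ (Finset.mem_union_right _ (hEx.M_subset_Q α y hv)), hM0 ?_⟩
    change v ∈ VWin G ρ t (P.M y) (Λ.rM α y) at hv
    exact φ_mem_of_mem_VWin hv
  · -- the last true target enters `M^{a'}_{y+du}` (by `Lip` of `ρ`: the footprint's unit box lies in `P.M (y+du)`)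
    rw [hlast]
    intro v hv
    obtain ⟨hvΩ, hvψ⟩ := (mem_WinIn (φ := ψ)).1 hv
    obtain ⟨hvM, hvH⟩ := hlast₂ v hvΩ hvψ
    have hvM0 : ρ v ∈ P.M (y + stepVec du) := hvM (Finset.mem_Icc.2 ⟨fun i => by simp, fun i => by simp⟩)
    change v ∈ VWin G ρ t (P.M (y + stepVec du)) (Λ.rM a' (y + stepVec du))
    rcases mem_Q_or_Hfull_of_mem_habΩ hdur hvΩ (Finset.mem_union_right _ hvH) with hvQ | hvHs
    · -- footprint in `P.Q y` and in `P.M (y+du) ⊆ P.Q (y+du)`: impossible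
      have h1 : ρ v ∈ P.Q y := φ_mem_of_mem_VWin hvQ
      have h2 : ρ v ∈ P.Q (y + stepVec du) := P.M_subset_Q _ hvM0
      have hne : y ≠ y + stepVec du := fun h' => by
        have h3 := congrArg (fun z => z du.1) h'
        simp only [Pi.add_apply, Literature.Probability.Percolation.KozmaNitzan.Cells.stepVec_apply_fst] at h3
        rcases Literature.Probability.Percolation.KozmaNitzan.Cells.sgOf_sign du with hs | hs <;> rw [hs] at h3 <;> linarith
      exact absurd h2 (Finset.disjoint_left.1 (P.Q_disjoint_Q hne) h1)
    · -- in the corridor span: take a span neighbour; both endpoints lie in the window over `P.M (y+du)`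
      obtain ⟨z, hz, hvz⟩ := exists_adj_of_mem_VStair hvHs
      obtain ⟨-, hdv⟩ := mem_of_mem_VStair hvHs
      obtain ⟨-, hdz⟩ := mem_of_mem_VStair hz
      have hρz : ρ z ∈ P.M (y + stepVec du) := by
        refine hvM (Finset.mem_Icc.2 ⟨fun i => ?_, fun i => ?_⟩)
        · have := (abs_le.1 (hlipρ hvz i)).2; simp only [Pi.sub_apply, Pi.one_apply]; linarith
        · have := (abs_le.1 (hlipρ hvz i)).1; simp only [Pi.add_apply, Pi.one_apply]; linarith
      have hvW : v ∈ Win G ρ t (P.M (y + stepVec du)) (Λ.rM a' (y + stepVec du)) :=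
        (mem_Win G ρ).2 ⟨graphBall_mono G t (by unfold prof; exact (Nat.le_succ _).trans (hρM _)) hdv, hvM0⟩
      have hzW : z ∈ Win G ρ t (P.M (y + stepVec du)) (Λ.rM a' (y + stepVec du)) :=
        (mem_Win G ρ).2 ⟨graphBall_mono G t (by unfold prof; exact (Nat.le_succ _).trans (hρM _)) hdz, hρz⟩
      exact (mem_vspan_edgesIn_of_adj hvW hzW hvz).1

end Skelφ

end Transplant

end Summit.CriticalPhenomena.PercolationContinuityZ3.Theorems

end
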